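import Literature.Geometry.Kaehler.SiegelTorusThetaDivisorTwoTorsionCount
import Literature.Geometry.Kaehler.SiegelTorusThetaNullGradient
import Literature.Analysis.SpecialFunctions.RiemannThetaTransformation
import Literature.Analysis.SpecialFunctions.RiemannThetaDiagonal
import Literature.NumberTheory.ModularForms.SiegelUpperHalfSpaceLevelCovering
import HarnessLib

/-!
# Theta constants with even characteristics do not vanish identically (odd ones do; second-order
# theta constants do not)

Layer `Literature/Geometry/Kaehler`, namespace `Literature.Geometry.Kaehler.ComplexTorus` (lane
`lit-hodgefound`, Layer A4, theta-divisor row A4-17; prover seat `lit-hodgefound-p23`, row «A4-17(o)»).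
Sequel of `SiegelTorusThetaParity.lean` (odd theta constants vanish: `riemannThetaChar_half_zero_of_odd`),
`SiegelTorusThetaNullCount.lean` / `SiegelTorusThetaDivisorTwoTorsionCount.lean` (the vanishing even theta
constants of `Ω` = the even two-division points on `Θ_Ω`), and of the theta-null strata files
`SiegelTorusThetaNullRank.lean` / `SiegelTorusThetaNullGradient.lean` (whose components `θ_{[k,l]}` are,
by the present file, genuine hypersurfaces: none of them is all of `𝔥_g`).

Source followed (held text, read at the quoted chunk): F. Dalla Piazza, R. Salvati Manni, *On the
Coble quartic and Fourier–Jacobi expansion of theta relations*, Internat. J. Math. 26 (2015)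
[held `paper:arxiv-1304.7659`, p0006]: "Theta constants are
restrictions of theta functions to `z = 0`; we drop the argument `z = 0` in the notations for theta
constants. All theta constants with odd characteristics vanish identically in `τ`, while theta
constants with even characteristics and all theta constants of the second order do not vanish
identically." (The same sentence: Dalla Piazza–Fiorentino–Grushevsky–Perna–Salvati Manni,
arXiv:0806.0354, p. 4; Grushevsky–Salvati Manni, *Two generalizations of Jacobi's derivative formula*,
Math. Res. Lett. 12 (2005), p. 1: "Obviously all odd theta constants vanish identically, and thus there
are `2^{g−1}(2^g+1)` non-trivial theta constants"; it is the input "the irreducible components [of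
`θ_null`] are the divisors of individual theta constants" of Grushevsky–Salvati Manni 2008, §2.)

The proof formalised here is elementary and explicit (no transitivity of `Sp(2g,ℤ)` on the even
characteristics is used): with `S(k,l) := {i : kᵢ, lᵢ odd}` (so `ᵗkl ≡ #S(k,l) mod 2`),
(1) at a DIAGONAL period matrix `ϑ[k/2; l/2](0, diag(τ₁,…,τ_g)) = const · ∏ᵢ ϑ(τᵢkᵢ/2 + lᵢ/2, τᵢ)`
vanishes iff `S(k,l) ≠ ∅` (the genus-one theta function vanishes exactly at the odd half period,
Whittaker–Watson §21.12); (2) for `i ≠ j` in `S(k,l)` the translation `Z ↦ Z + (Eᵢⱼ + Eⱼᵢ)` of `𝔥_g`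
turns `ϑ[k/2; l/2]` into a non-zero multiple of `ϑ[k/2; l'/2]` with `l' = l − (Eᵢⱼ + Eⱼᵢ)k`, and
`S(k,l') = S(k,l) ∖ {i,j}` (Lange's theta transformation formula for `M = (1 β; 0 1)`, the tree's
`riemannThetaChar_transform_translation`); (3) induction on `#S(k,l)`, which is even.

What is here (theorems only; no definition, no named fact, net debt `0`):

* `riemannThetaChar_half_zero_diagonal_eq_zero_iff` — **at a diagonal period matrix,
  `ϑ[k/2; l/2](0, diag τ) = 0 ↔ ∃ i, kᵢ odd ∧ lᵢ odd`**; `diagonal_mem_siegelUpperHalfSpace`.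
* `riemannThetaChar_half_zero_translate_pair` — the translation step (2), with its explicit constant;
  `sub_pairMatrix_mem_siegelUpperHalfSpace` (`Z − β ∈ 𝔥_g`).
* `even_dotProduct_iff_even_card_oddSupport` — `ᵗkl` is even iff `#S(k,l)` is even.
* **`exists_riemannThetaChar_half_zero_ne_zero_of_even`** — for `k, l ∈ ℤ^g` with `ᵗkl` even there is
  `Ω ∈ 𝔥_g` with `ϑ[k/2; l/2](0, Ω) ≠ 0`; **`forall_riemannThetaChar_half_zero_eq_zero_iff_odd`** —
  `ϑ[k/2; l/2](0, ·) ≡ 0` on `𝔥_g` iff `ᵗkl` is odd (the printed dichotomy).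
* `riemannThetaChar_half_zero_two_smul_diagonal_ne_zero`, **`exists_secondOrder_thetaConst_ne_zero`** —
  the second-order theta constants `Θ[σ](τ) = ϑ[σ/2; 0](0, 2τ)` are non-zero at every diagonal `τ`,
  hence do not vanish identically.
* Torus reading (the principally polarised `X_Ω = ℂ^g/(Ωℤ^g + ℤ^g)`, `Θ_Ω = thetaDivisor`):
  **`exists_proj_half_notMem_thetaDivisor_of_even`** — for every EVEN two-torsion class `½m` there is
  `Ω ∈ 𝔥_g` whose theta divisor misses the point `π(½m)`; `not_forall_memThetaNullRankAt` — no
  component `θ_{[k,l]}` (`[k,l]` even) of `θ_null` is all of `𝔥_g`.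
* **Identity-theorem upgrade** (§7; `𝔥_g` convex, the theta constants analytic on it):
  `analyticOnNhd_riemannThetaChar_const`, `isPreconnected_siegelUpperHalfSpace`,
  **`riemannThetaChar_half_zero_not_eventuallyEq_zero`** (an even theta constant is not identically zero
  near ANY point of `𝔥_g`: its zero locus has empty interior),
  `exists_mem_riemannThetaChar_half_zero_ne_zero_of_isOpen`, `secondOrder_thetaConst_not_eventuallyEq_zero`.

Not here: transitivity of `Sp(2g,ℤ)` on even characteristics, "no theta constant vanishes identically on
the Jacobian locus" (GSM 2008, Lemma 11).

## References

* [DallaPiazzaSalvatiManni2015] F. Dalla Piazza, R. Salvati Manni, *On the Coble quartic and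
  Fourier–Jacobi expansion of theta relations*, Internat. J. Math. 26 (2015), 1550019
  (arXiv:1304.7659), §1 p. 6 of the held text.
* [GrushevskySalvatiManni2008] S. Grushevsky, R. Salvati Manni, *Jacobians with a vanishing theta-null
  in genus 4*, Israel J. Math. 164 (2008), §2.
* [Lange2023AbelianVarietiesComplex] H. Lange, *Abelian Varieties over the Complex Numbers* (2023),
  §3.3.3 Thm. 3.3.9 (theta transformation formula).
* [WhittakerWatson1927] E. T. Whittaker, G. N. Watson, *A Course of Modern Analysis*, §21.12.
* [MumfordTata1] D. Mumford, *Tata Lectures on Theta I*, Ch. II §1.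
-/

noncomputable section

open scoped Manifold Topology
open scoped Real
open Set Function Complex Matrix Filter
open Literature.Analysis.SpecialFunctions Literature.Analysis.Complex

namespace Literature.Geometry.Kaehler

namespace ComplexTorus

open Literature.NumberTheory.Automorphic (siegelUpperHalfSpace)

variable {n : ℕ}

/-! ### §1 Theta constants at diagonal period matrices -/

/-- From `τ p = q` with `p, q` real and `Im τ ≠ 0`: `p = 0` and `q = 0`. [folklore] -/
private theorem eq_zero_of_mul_ofReal_eq_ofReal {τ : ℂ} (hτ : τ.im ≠ 0) {p q : ℝ}
    (h : τ * (p : ℂ) = (q : ℂ)) : p = 0 ∧ q = 0 := by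
  have him := congrArg Complex.im h
  simp only [Complex.mul_im, Complex.ofReal_re, Complex.ofReal_im, mul_zero, zero_add] at him
  have hp : p = 0 := by
    rcases mul_eq_zero.1 him with h1 | h1
    · exact absurd h1 hτ
    · exact h1
  refine ⟨hp, ?_⟩
  have hre := congrArg Complex.re h
  simp only [hp, Complex.ofReal_zero, mul_zero, Complex.zero_re, Complex.ofReal_re] at hre
  exact hre.symm

/-- **The genus-one zero criterion at a half-integer point**: for `Im τ > 0` and `k, l ∈ ℤ`,
`τk/2 + l/2` is a lattice translate of the odd half period `(1 + τ)/2` iff `k` and `l` are both odd.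
[cite: WhittakerWatson1927, §21.12] -/
theorem exists_half_eq_halfPeriod_add_iff {τ : ℂ} (hτ : 0 < τ.im) (k l : ℤ) :
    (∃ m m' : ℤ, τ * ((k : ℂ) / 2) + (l : ℂ) / 2 = (1 + τ) / 2 + m + m' * τ) ↔ Odd k ∧ Odd l := by
  constructor
  · rintro ⟨m, m', h⟩
    -- `τ (k/2 − 1/2 − m') = 1/2 + m − l/2`
    have h' : τ * (((k : ℝ) / 2 - 1 / 2 - (m' : ℝ) : ℝ) : ℂ) = (((1 : ℝ) / 2 + (m : ℝ) - (l : ℝ) / 2 : ℝ) : ℂ) := by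
      push_cast
      linear_combination h
    obtain ⟨hp, hq⟩ := eq_zero_of_mul_ofReal_eq_ofReal hτ.ne' h'
    refine ⟨⟨m', ?_⟩, ⟨m, ?_⟩⟩
    · have : (k : ℝ) = 2 * (m' : ℝ) + 1 := by linarith
      exact_mod_cast this
    · have : (l : ℝ) = 2 * (m : ℝ) + 1 := by linarith
      exact_mod_cast this
  · rintro ⟨⟨m', hk⟩, ⟨m, hl⟩⟩
    refine ⟨m, m', ?_⟩
    rw [hk, hl]
    push_cast
    ring

/-- **Theta constants at a DIAGONAL period matrix: `ϑ[k/2; l/2](0, diag(τ₁, …, τ_g)) = 0` iff some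
coordinate pair `(kᵢ, lᵢ)` is (odd, odd)** — `ϑ[k/2; l/2](0, Ω) = e(…) ϑ(Ωk/2 + l/2, Ω)` and
`ϑ(z, diag τ) = ∏ᵢ ϑ(zᵢ, τᵢ)` vanishes iff some `zᵢ` is a translate of the odd half period `(1 + τᵢ)/2`.
So a theta constant with `S(k,l) = {i : kᵢ, lᵢ odd} = ∅` is non-zero at every diagonal point of `𝔥_g`.
[cite: DallaPiazzaSalvatiManni2015, §1 (p0006 of the held text)] [cite: WhittakerWatson1927, §21.12] -/
theorem riemannThetaChar_half_zero_diagonal_eq_zero_iff (τ : Fin n → ℂ) (hτ : ∀ i, 0 < (τ i).im)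
    (k l : Fin n → ℤ) :
    riemannThetaChar (fun i ↦ (k i : ℂ) / 2) (fun i ↦ (l i : ℂ) / 2) (Matrix.diagonal τ) 0 = 0 ↔
      ∃ i, Odd (k i) ∧ Odd (l i) := by
  have hsym : ∀ i j, Matrix.diagonal τ i j = Matrix.diagonal τ j i := fun i j ↦ by
    rw [← Matrix.diagonal_transpose, Matrix.transpose_apply, Matrix.diagonal_transpose]
  rw [riemannThetaChar_eq_cexp_mul_riemannTheta _ hsym, mul_eq_zero, or_iff_right (Complex.exp_ne_zero _),
    zero_add, riemannTheta_diagonal_eq_zero_iff τ hτ]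
  refine exists_congr fun i ↦ ?_
  rw [Pi.add_apply, Matrix.mulVec_diagonal]
  exact exists_half_eq_halfPeriod_add_iff (hτ i) (k i) (l i)

/-- **A diagonal period matrix with entries in the upper half plane lies in `𝔥_g`.**
[cite: Lange2023AbelianVarietiesComplex, §3.1.1 (the Siegel upper half space)] -/
theorem diagonal_mem_siegelUpperHalfSpace (τ : Fin n → ℂ) (hτ : ∀ i, 0 < (τ i).im) :
    Matrix.diagonal τ ∈ siegelUpperHalfSpace n := by
  refine ⟨Matrix.diagonal_transpose τ, ?_⟩
  have h : (Matrix.diagonal τ).map Complex.im = Matrix.diagonal fun i ↦ (τ i).im := by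
    ext i j
    by_cases hij : i = j
    · subst hij; simp
    · simp [Matrix.diagonal_apply_ne _ hij]
  rw [h]
  exact Matrix.PosDef.diagonal hτ

/-! ### §2 The translation step `Z ↦ Z + (Eᵢⱼ + Eⱼᵢ)` -/

/-- The matrix `Eᵢⱼ + Eⱼᵢ` (`i ≠ j`) pairing two indices: symmetric, integral, zero diagonal. [folklore] -/
private theorem isSymm_pairMatrix (i j : Fin n) :
    (Matrix.single i j (1 : ℤ) + Matrix.single j i 1).IsSymm := by
  unfold Matrix.IsSymm
  rw [Matrix.transpose_add, Matrix.transpose_single, Matrix.transpose_single, add_comm]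

/-- `diag(Eᵢⱼ + Eⱼᵢ) = 0` for `i ≠ j`. [folklore] -/
private theorem diag_pairMatrix {i j : Fin n} (hij : i ≠ j) :
    Matrix.diag (Matrix.single i j (1 : ℤ) + Matrix.single j i 1) = 0 := by
  funext m
  simp only [Matrix.diag_apply, Matrix.add_apply, Pi.zero_apply]
  rw [Matrix.single_apply_of_ne (h := fun h ↦ hij (h.1.trans h.2.symm)),
    Matrix.single_apply_of_ne (h := fun h ↦ hij (h.1.trans h.2.symm).symm), add_zero]

/-- `(Eᵢⱼ + Eⱼᵢ)k` has `kⱼ` at `i`, `kᵢ` at `j`, and `0` elsewhere (`i ≠ j`). [folklore] -/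
private theorem pairMatrix_mulVec_apply {i j : Fin n} (_hij : i ≠ j) (k : Fin n → ℤ) (m : Fin n) :
    ((Matrix.single i j (1 : ℤ) + Matrix.single j i 1) *ᵥ k) m =
      (if m = i then k j else 0) + (if m = j then k i else 0) := by
  rw [Matrix.add_mulVec, Pi.add_apply, Matrix.single_mulVec, Matrix.single_mulVec, one_mul, one_mul,
    Function.update_apply, Function.update_apply, Pi.zero_apply]

/-- **The translation step** (Lange's theta transformation formula for `M = (1 β; 0 1)`, the tree's
`riemannThetaChar_transform_translation`, at `β = Eᵢⱼ + Eⱼᵢ`, `i ≠ j`, which has `(β)₀ = 0`): for all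
`k, l ∈ ℤ^g` and every `Z`,
`ϑ[k/2; (l − βk)/2](0, Z + β) = e(−πi ᵗ(k/2)β(k/2)) · ϑ[k/2; l/2](0, Z)`.
[cite: Lange2023AbelianVarietiesComplex, §3.3.3 Thm. 3.3.9 (p0175); §3.3.4 Exercise (7)(c)]
[cite: DallaPiazzaSalvatiManni2015, §1 (p0006 of the held text)] -/
theorem riemannThetaChar_half_zero_translate_pair {i j : Fin n} (hij : i ≠ j) (k l : Fin n → ℤ)
    (Z : Matrix (Fin n) (Fin n) ℂ) :
    riemannThetaChar (fun m ↦ (k m : ℂ) / 2)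
        (fun m ↦ ((l m - ((Matrix.single i j (1 : ℤ) + Matrix.single j i 1) *ᵥ k) m : ℤ) : ℂ) / 2)
        (Z + (Matrix.single i j (1 : ℤ) + Matrix.single j i 1).map ((↑) : ℤ → ℂ)) 0 =
      cexp (-(π * I * ((fun m ↦ (k m : ℂ) / 2) ⬝ᵥ
          (Matrix.single i j (1 : ℤ) + Matrix.single j i 1).map ((↑) : ℤ → ℂ) *ᵥ fun m ↦ (k m : ℂ) / 2))) *
        riemannThetaChar (fun m ↦ (k m : ℂ) / 2) (fun m ↦ (l m : ℂ) / 2) Z 0 := by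
  set β : Matrix (Fin n) (Fin n) ℤ := Matrix.single i j (1 : ℤ) + Matrix.single j i 1 with hβ
  have h := riemannThetaChar_transform_translation (isSymm_pairMatrix i j) Z (fun m ↦ (k m : ℂ) / 2)
    (fun m ↦ (l m : ℂ) / 2) 0
  rw [← hβ] at h
  have hdiag : (fun m ↦ ((Matrix.diag β m : ℤ) : ℂ)) = 0 := by
    funext m
    rw [hβ, diag_pairMatrix hij]
    simp
  rw [hdiag, smul_zero, add_zero, dotProduct_zero, mul_zero, add_zero] at h
  -- the second characteristic: `l/2 − β(k/2) = (l − βk)/2`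
  have hchar : (fun m ↦ (l m : ℂ) / 2) - β.map ((↑) : ℤ → ℂ) *ᵥ (fun m ↦ (k m : ℂ) / 2) =
      fun m ↦ ((l m - (β *ᵥ k) m : ℤ) : ℂ) / 2 := by
    funext m
    have hmv : (β.map ((↑) : ℤ → ℂ) *ᵥ fun m ↦ (k m : ℂ) / 2) m = (((β *ᵥ k) m : ℤ) : ℂ) / 2 := by
      simp only [Matrix.mulVec, dotProduct, Matrix.map_apply, Int.cast_sum, Int.cast_mul, Finset.sum_div]
      exact Finset.sum_congr rfl fun b _ ↦ by ring
    rw [Pi.sub_apply, hmv]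
    push_cast
    ring
  rw [hchar] at h
  exact h

/-- **The translation removes the pair `{i, j}` from `S(k,l) = {m : k_m, l_m odd}`** (`i ≠ j`, both in
`S(k,l)`): `l' = l − (Eᵢⱼ + Eⱼᵢ)k` has `l'ᵢ = lᵢ − kⱼ`, `l'ⱼ = lⱼ − kᵢ` even and `l'_m = l_m` otherwise.
[cite: DallaPiazzaSalvatiManni2015, §1 (p0006 of the held text)] -/
theorem oddSupport_translate_pair {i j : Fin n} (hij : i ≠ j) (k l : Fin n → ℤ)
    (hi : Odd (k i) ∧ Odd (l i)) (hj : Odd (k j) ∧ Odd (l j)) :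
    (Finset.univ.filter fun m ↦ Odd (k m) ∧
        Odd (l m - ((Matrix.single i j (1 : ℤ) + Matrix.single j i 1) *ᵥ k) m)) =
      ((Finset.univ.filter fun m ↦ Odd (k m) ∧ Odd (l m)).erase i).erase j := by
  ext m
  rw [Finset.mem_erase, Finset.mem_erase, Finset.mem_filter, Finset.mem_filter, pairMatrix_mulVec_apply hij]
  by_cases hmi : m = i
  · subst hmi
    rw [if_pos rfl, if_neg hij, add_zero]
    constructor
    · rintro ⟨-, -, hodd⟩
      exact absurd (hi.2.sub_odd hj.1) (Int.not_even_iff_odd.2 hodd)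
    · rintro ⟨-, hne, -⟩
      exact absurd rfl hne
  · by_cases hmj : m = j
    · subst hmj
      rw [if_neg hmi, if_pos rfl, zero_add]
      constructor
      · rintro ⟨-, -, hodd⟩
        exact absurd (hj.2.sub_odd hi.1) (Int.not_even_iff_odd.2 hodd)
      · rintro ⟨hne, -⟩
        exact absurd rfl hne
    · rw [if_neg hmi, if_neg hmj, add_zero, sub_zero]
      simp only [Finset.mem_univ, true_and, ne_eq, hmj, not_false_eq_true, hmi]

/-- **`Z − β ∈ 𝔥_g` for `Z ∈ 𝔥_g` and a real symmetric integral `β`** (here `β = Eᵢⱼ + Eⱼᵢ`): the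
translations of Lange's `G_{1_g} ∋ (1 β; 0 1)` act on `𝔥_g`. [cite: Lange2023AbelianVarietiesComplex, §3.1.3 Prop. 3.1.6 (p0160)] -/
theorem sub_intCast_mem_siegelUpperHalfSpace {Z : Matrix (Fin n) (Fin n) ℂ} (hZ : Z ∈ siegelUpperHalfSpace n)
    {β : Matrix (Fin n) (Fin n) ℤ} (hβ : β.IsSymm) :
    Z - β.map ((↑) : ℤ → ℂ) ∈ siegelUpperHalfSpace n := by
  refine ⟨hZ.1.sub (hβ.map _), ?_⟩
  have h : (Z - β.map ((↑) : ℤ → ℂ)).map Complex.im = Z.map Complex.im := by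
    ext a b
    simp
  rw [h]
  exact hZ.2

/-! ### §3 Parity: `ᵗkl ≡ #S(k,l) (mod 2)` -/

/-- In `ℤ/2`: the class of an integer is `1` if it is odd and `0` if it is even. [folklore] -/
private theorem intCast_zmod_two_eq_ite (a : ℤ) : (a : ZMod 2) = if Odd a then 1 else 0 := by
  split_ifs with h
  · obtain ⟨r, hr⟩ := h
    rw [hr, Int.cast_add, Int.cast_mul, Int.cast_one]
    have h2 : ((2 : ℤ) : ZMod 2) = 0 := by decide
    rw [h2, zero_mul, zero_add]
  · rw [ZMod.intCast_zmod_eq_zero_iff_dvd]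
    exact even_iff_two_dvd.1 (Int.not_odd_iff_even.1 h)

/-- **`ᵗkl` is even iff the number of coordinates with `kᵢ, lᵢ` both odd is even**
(`kᵢlᵢ ≡ [kᵢ odd][lᵢ odd] mod 2`). [cite: MumfordTata1, Ch. II §1] -/
theorem even_dotProduct_iff_even_card_oddSupport (k l : Fin n → ℤ) :
    Even (k ⬝ᵥ l) ↔ Even (Finset.univ.filter fun m ↦ Odd (k m) ∧ Odd (l m)).card := by
  rw [← sum_intCast_mul_intCast_eq_zero_iff]
  have hterm : ∀ m, (k m : ZMod 2) * (l m : ZMod 2) = if Odd (k m) ∧ Odd (l m) then 1 else 0 := by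
    intro m
    rw [intCast_zmod_two_eq_ite, intCast_zmod_two_eq_ite]
    by_cases hk : Odd (k m) <;> by_cases hl : Odd (l m) <;> simp [hk, hl]
  simp_rw [hterm]
  rw [Finset.sum_boole, ZMod.natCast_eq_zero_iff_even]

/-! ### §4 Even theta constants do not vanish identically -/

/-- The induction behind the main theorem: if `#S(k,l)` is even, `ϑ[k/2; l/2](0, ·)` is non-zero
somewhere on `𝔥_g` (remove the pairs of `S(k,l)` by translations, then evaluate at a diagonal point).
[cite: DallaPiazzaSalvatiManni2015, §1 (p0006 of the held text)] -/
private theorem exists_ne_zero_of_even_card :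
    ∀ (N : ℕ) (k l : Fin n → ℤ), (Finset.univ.filter fun m ↦ Odd (k m) ∧ Odd (l m)).card = N → Even N →
      ∃ Ω ∈ siegelUpperHalfSpace n,
        riemannThetaChar (fun m ↦ (k m : ℂ) / 2) (fun m ↦ (l m : ℂ) / 2) Ω 0 ≠ 0 := by
  intro N
  induction N using Nat.strong_induction_on with
  | _ N ih =>
    intro k l hcard hN
    rcases Nat.eq_zero_or_pos N with h0 | hpos
    · -- no coincidence: the diagonal point `i · 1_g`
      subst h0
      refine ⟨Matrix.diagonal fun _ ↦ I, diagonal_mem_siegelUpperHalfSpace _ fun _ ↦ by simp, ?_⟩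
      rw [Ne, riemannThetaChar_half_zero_diagonal_eq_zero_iff _ (fun _ ↦ by simp), not_exists]
      intro m hm
      have : m ∈ (Finset.univ.filter fun m ↦ Odd (k m) ∧ Odd (l m)) :=
        Finset.mem_filter.2 ⟨Finset.mem_univ _, hm⟩
      rw [Finset.card_eq_zero.1 hcard] at this
      exact absurd this (Finset.notMem_empty _)
    · -- two coincidences `i ≠ j`: translate by `β = Eᵢⱼ + Eⱼᵢ`
      have h2 : 2 ≤ N := by
        obtain ⟨r, hr⟩ := hN
        omega
      obtain ⟨i, hi⟩ : (Finset.univ.filter fun m ↦ Odd (k m) ∧ Odd (l m)).Nonempty :=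
        Finset.card_pos.1 (hcard ▸ hpos)
      obtain ⟨j, hj, hji⟩ : ∃ j ∈ (Finset.univ.filter fun m ↦ Odd (k m) ∧ Odd (l m)), j ≠ i := by
        have hc : 1 < ((Finset.univ.filter fun m ↦ Odd (k m) ∧ Odd (l m))).card := by omega
        exact Finset.exists_mem_ne hc i
      have hi' := (Finset.mem_filter.1 hi).2
      have hj' := (Finset.mem_filter.1 hj).2
      set β : Matrix (Fin n) (Fin n) ℤ := Matrix.single i j (1 : ℤ) + Matrix.single j i 1 with hβ
      set l' : Fin n → ℤ := fun m ↦ l m - (β *ᵥ k) m with hl'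
      have hjmem : j ∈ (Finset.univ.filter fun m ↦ Odd (k m) ∧ Odd (l m)).erase i :=
        Finset.mem_erase.2 ⟨hji, hj⟩
      have hcard' : (Finset.univ.filter fun m ↦ Odd (k m) ∧ Odd (l' m)).card = N - 2 := by
        rw [hl', hβ, oddSupport_translate_pair hji.symm k l hi' hj', Finset.card_erase_of_mem hjmem,
          Finset.card_erase_of_mem hi, hcard]
        omega
      have hN' : Even (N - 2) := by
        obtain ⟨r, hr⟩ := hN
        exact ⟨r - 1, by omega⟩
      obtain ⟨Ω', hΩ', hne⟩ := ih (N - 2) (by omega) k l' hcard' hN'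
      refine ⟨Ω' - β.map ((↑) : ℤ → ℂ), sub_intCast_mem_siegelUpperHalfSpace hΩ' (isSymm_pairMatrix i j),
        fun h0 ↦ hne ?_⟩
      have ht := riemannThetaChar_half_zero_translate_pair hji.symm k l (Ω' - β.map ((↑) : ℤ → ℂ))
      rw [sub_add_cancel, ← hβ, h0, mul_zero] at ht
      simpa only [hl'] using ht

/-- **Theta constants with EVEN characteristics do not vanish identically**: for `k, l ∈ ℤ^g` with
`ᵗkl` even there is `Ω ∈ 𝔥_g` with `ϑ[k/2; l/2](0, Ω) ≠ 0` ("theta constants with even characteristics …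
do not vanish identically"). [cite: DallaPiazzaSalvatiManni2015, §1 (p0006 of the held text)]
[cite: GrushevskySalvatiManni2008, §2 (p0006 of the held text)] -/
theorem exists_riemannThetaChar_half_zero_ne_zero_of_even (k l : Fin n → ℤ) (h : Even (k ⬝ᵥ l)) :
    ∃ Ω ∈ siegelUpperHalfSpace n,
      riemannThetaChar (fun m ↦ (k m : ℂ) / 2) (fun m ↦ (l m : ℂ) / 2) Ω 0 ≠ 0 :=
  exists_ne_zero_of_even_card _ k l rfl ((even_dotProduct_iff_even_card_oddSupport k l).1 h)

/-- **The printed dichotomy: a theta constant `ϑ[k/2; l/2](0, ·)` vanishes identically on `𝔥_g` iff its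
characteristic is ODD** ("All theta constants with odd characteristics vanish identically in `τ`, while
theta constants with even characteristics … do not vanish identically"; the odd half is the tree's
`riemannThetaChar_half_zero_of_odd`). [cite: DallaPiazzaSalvatiManni2015, §1 (p0006 of the held text)]
[cite: MumfordTata1, Ch. II §1] -/
theorem forall_riemannThetaChar_half_zero_eq_zero_iff_odd (k l : Fin n → ℤ) :
    (∀ Ω ∈ siegelUpperHalfSpace n,
        riemannThetaChar (fun m ↦ (k m : ℂ) / 2) (fun m ↦ (l m : ℂ) / 2) Ω 0 = 0) ↔ Odd (k ⬝ᵥ l) := by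
  refine ⟨fun h ↦ Int.not_even_iff_odd.1 fun heven ↦ ?_, fun hodd Ω _ ↦
    riemannThetaChar_half_zero_of_odd k l Ω hodd⟩
  obtain ⟨Ω, hΩ, hne⟩ := exists_riemannThetaChar_half_zero_ne_zero_of_even k l heven
  exact hne (h Ω hΩ)

/-- **There are non-trivial theta constants: `ϑ[0; 0](0, ·)` is not identically zero** (indeed non-zero
at every diagonal point). [cite: DallaPiazzaSalvatiManni2015, §1 (p0006 of the held text)] -/
theorem exists_riemannThetaChar_zero_zero_ne_zero :
    ∃ Ω ∈ siegelUpperHalfSpace n, riemannThetaChar (0 : Fin n → ℂ) 0 Ω 0 ≠ 0 := by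
  obtain ⟨Ω, hΩ, hne⟩ := exists_riemannThetaChar_half_zero_ne_zero_of_even (0 : Fin n → ℤ) 0
    (by simp)
  have h0 : (fun m : Fin n ↦ (((0 : Fin n → ℤ) m : ℤ) : ℂ) / 2) = 0 := by
    funext m; simp
  rw [h0] at hne
  exact ⟨Ω, hΩ, hne⟩

/-! ### §5 Second-order theta constants do not vanish identically -/

/-- **The second-order theta constants `Θ[σ](τ) = ϑ[σ/2; 0](0, 2τ)` are non-zero at every diagonal
`τ`** (`σ ∈ ℤ^g`; the second characteristic is `0`, so no coordinate pair is (odd, odd)).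
[cite: DallaPiazzaSalvatiManni2015, §1 (p0006 of the held text)] [cite: WhittakerWatson1927, §21.12] -/
theorem riemannThetaChar_half_zero_two_smul_diagonal_ne_zero (τ : Fin n → ℂ) (hτ : ∀ i, 0 < (τ i).im)
    (σ : Fin n → ℤ) :
    riemannThetaChar (fun i ↦ (σ i : ℂ) / 2) 0 ((2 : ℂ) • Matrix.diagonal τ) 0 ≠ 0 := by
  have h2 : (2 : ℂ) • Matrix.diagonal τ = Matrix.diagonal fun i ↦ 2 * τ i := by
    rw [← Matrix.diagonal_smul]
    rfl
  have h0 : (fun i ↦ (((0 : Fin n → ℤ) i : ℤ) : ℂ) / 2) = (0 : Fin n → ℂ) := by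
    funext i; simp
  have key := riemannThetaChar_half_zero_diagonal_eq_zero_iff (fun i ↦ 2 * τ i)
    (fun i ↦ by simpa using mul_pos two_pos (hτ i)) σ 0
  rw [h0] at key
  rw [h2, Ne, key, not_exists]
  intro i hi
  exact (Int.not_even_iff_odd.2 hi.2) (by simp)

/-- **"All theta constants of the second order do not vanish identically"**: for every `σ ∈ ℤ^g` there
is `τ ∈ 𝔥_g` with `Θ[σ](τ) = ϑ[σ/2; 0](0, 2τ) ≠ 0`. [cite: DallaPiazzaSalvatiManni2015, §1 (p0006 of the held text)] -/
theorem exists_secondOrder_thetaConst_ne_zero (σ : Fin n → ℤ) :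
    ∃ τ ∈ siegelUpperHalfSpace n, riemannThetaChar (fun i ↦ (σ i : ℂ) / 2) 0 ((2 : ℂ) • τ) 0 ≠ 0 :=
  ⟨Matrix.diagonal fun _ ↦ I, diagonal_mem_siegelUpperHalfSpace _ fun _ ↦ by simp,
    riemannThetaChar_half_zero_two_smul_diagonal_ne_zero _ (fun _ ↦ by simp) σ⟩

/-! ### §6 Torus reading: even two-torsion points off `Θ`, proper components of `θ_null` -/

/-- **For every EVEN two-torsion class there is a principally polarised `(X_Ω, Θ_Ω)` whose theta divisor
misses it**: for `m ∈ ℤ^{2g}` with `Σ m_{inl i} m_{inr i}` even there is `Ω ∈ 𝔥_g` such that the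
two-division point `π(½m)` of the Siegel torus `X_Ω` does not lie on `Θ_Ω` (for odd `m` it always does,
`proj_half_mem_thetaDivisor_of_odd`). [cite: DallaPiazzaSalvatiManni2015, §1 (p0006 of the held text)]
[cite: Lange2023AbelianVarietiesComplex, §2.3.4 Prop. 2.3.14] -/
theorem exists_proj_half_notMem_thetaDivisor_of_even (m : Fin n ⊕ Fin n → ℤ)
    (heven : Even (∑ i, m (Sum.inl i) * m (Sum.inr i))) :
    ∃ (Ω : Matrix (Fin n) (Fin n) ℂ) (hΩ : ∀ i j, Ω i j = Ω j i)
      (hpos : (Matrix.of fun i j => (Ω i j).im).PosDef),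
      ∀ (Φ : (Fin n ⊕ Fin n → ℝ) ≃L[ℝ] (Fin n → ℂ))
        (hΦ : ∀ v i, Φ v i = (v (Sum.inl i) : ℂ) + ∑ j, Ω i j * (v (Sum.inr j) : ℂ)),
        proj Φ (fun i ↦ (m i : ℝ) / 2) ∉ thetaDivisor Ω hΩ hpos Φ hΦ := by
  have heven' : Even ((fun j ↦ m (Sum.inr j)) ⬝ᵥ fun i ↦ m (Sum.inl i)) := by
    have hc : (fun j ↦ m (Sum.inr j)) ⬝ᵥ (fun i ↦ m (Sum.inl i)) = ∑ i, m (Sum.inl i) * m (Sum.inr i) := by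
      simp only [dotProduct, mul_comm]
    rwa [hc]
  obtain ⟨Ω, hΩ, hne⟩ := exists_riemannThetaChar_half_zero_ne_zero_of_even _ _ heven'
  have hΩs : ∀ i j, Ω i j = Ω j i := fun i j ↦ (hΩ.1.apply i j).symm
  refine ⟨Ω, hΩs, hΩ.2, fun Φ hΦ hmem ↦ hne ?_⟩
  rw [proj_half_eq_cover Ω Φ hΦ m, cover_mem_thetaDivisor_iff] at hmem
  exact (riemannThetaChar_half_zero_eq_zero_iff Ω hΩs _ _).2 hmem

/-- **No even component `θ_{[k,l]}` of `θ_null` is all of `𝔥_g`**: for `ᵗkl` even and every `h`, some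
`Ω ∈ 𝔥_g` is not in `θ_{[k,l]}^h` (the theta-null divisors "of individual theta constants" are proper).
[cite: GrushevskySalvatiManni2008, §2 (p0006 of the held text)] [cite: DallaPiazzaSalvatiManni2015, §1 (p0006 of the held text)] -/
theorem not_forall_memThetaNullRankAt (k l : Fin n → ℤ) (heven : Even (k ⬝ᵥ l)) (h : ℕ) :
    ¬ ∀ Ω ∈ siegelUpperHalfSpace n, MemThetaNullRankAt k l h Ω := by
  intro hall
  obtain ⟨Ω, hΩ, hne⟩ := exists_riemannThetaChar_half_zero_ne_zero_of_even k l heven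
  exact hne (hall Ω hΩ).eq_zero

/-! ### §7 The identity theorem upgrade: an even theta constant vanishes on no open piece of `𝔥_g` -/

section Identity

open scoped Matrix.Norms.Elementwise

/-- **The theta constants `Ω ↦ ϑ[a; b](0, Ω)` are analytic on `𝔥_g`** (Lange–Birkenhake Prop. 3.3.6,
the tree's joint analyticity `analyticAt_riemannThetaChar_prod`, along `Ω ↦ (0, Ω)`).
[cite: LangeBirkenhake1992, §3.3.2 Prop. 3.3.6] -/
theorem analyticOnNhd_riemannThetaChar_const (a b : Fin n → ℂ) :
    AnalyticOnNhd ℂ (fun Ω : Matrix (Fin n) (Fin n) ℂ ↦ riemannThetaChar a b Ω 0) (siegelUpperHalfSpace n) := by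
  intro Ω hΩ
  obtain ⟨c, hc, hY⟩ := exists_pos_mul_sum_sq_le_of_posDef_im Ω hΩ.2
  exact (analyticAt_riemannThetaChar_prod a b Ω hc hY 0).comp₂ analyticAt_const analyticAt_id

/-- `𝔥_g` is preconnected (it is convex). [cite: CharlesSchnell2014Notes, Thm. 11.5.10 (discussion, p. 516)] -/
theorem isPreconnected_siegelUpperHalfSpace : IsPreconnected (siegelUpperHalfSpace n) :=
  Literature.NumberTheory.ModularForms.SiegelUpperHalfSpace.convex_siegelUpperHalfSpace.isPreconnected

/-- **An EVEN theta constant is not identically zero near any point of `𝔥_g`** ("do not vanish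
identically", upgraded by the identity theorem for analytic functions on the connected `𝔥_g`): for
`ᵗkl` even and every `Ω₀ ∈ 𝔥_g`, `ϑ[k/2; l/2](0, ·)` is not eventually `0` at `Ω₀` — the theta-null
hypersurface `{ϑ[k/2; l/2](0, ·) = 0} ∩ 𝔥_g` has empty interior.
[cite: DallaPiazzaSalvatiManni2015, §1 (p0006 of the held text)] [cite: GrushevskySalvatiManni2008, §2 (p0006 of the held text)] -/
theorem riemannThetaChar_half_zero_not_eventuallyEq_zero (k l : Fin n → ℤ) (heven : Even (k ⬝ᵥ l))
    {Ω₀ : Matrix (Fin n) (Fin n) ℂ} (hΩ₀ : Ω₀ ∈ siegelUpperHalfSpace n) :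
    ¬ (fun Ω : Matrix (Fin n) (Fin n) ℂ ↦
        riemannThetaChar (fun m ↦ (k m : ℂ) / 2) (fun m ↦ (l m : ℂ) / 2) Ω 0) =ᶠ[𝓝 Ω₀] 0 := by
  intro h
  obtain ⟨Ω, hΩ, hne⟩ := exists_riemannThetaChar_half_zero_ne_zero_of_even k l heven
  exact hne ((analyticOnNhd_riemannThetaChar_const _ _).eqOn_zero_of_preconnected_of_eventuallyEq_zero
    isPreconnected_siegelUpperHalfSpace hΩ₀ h hΩ)

/-- **Every open set meeting `𝔥_g` contains a point where the even theta constant is non-zero.**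
[cite: DallaPiazzaSalvatiManni2015, §1 (p0006 of the held text)] -/
theorem exists_mem_riemannThetaChar_half_zero_ne_zero_of_isOpen (k l : Fin n → ℤ) (heven : Even (k ⬝ᵥ l))
    {U : Set (Matrix (Fin n) (Fin n) ℂ)} (hU : IsOpen U) {Ω₀ : Matrix (Fin n) (Fin n) ℂ} (hΩ₀U : Ω₀ ∈ U)
    (hΩ₀ : Ω₀ ∈ siegelUpperHalfSpace n) :
    ∃ Ω ∈ U, riemannThetaChar (fun m ↦ (k m : ℂ) / 2) (fun m ↦ (l m : ℂ) / 2) Ω 0 ≠ 0 := by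
  by_contra hcon
  simp only [not_exists, not_and, not_not] at hcon
  exact riemannThetaChar_half_zero_not_eventuallyEq_zero k l heven hΩ₀
    (Filter.eventuallyEq_of_mem (hU.mem_nhds hΩ₀U) fun Ω hΩ ↦ hcon Ω hΩ)

/-- **The second-order theta constants `Θ[σ] = ϑ[σ/2; 0](0, 2·)` vanish on no open piece of `𝔥_g`**
(`[σ, 0]` is an even characteristic; `τ ↦ 2τ` preserves `𝔥_g`). [cite: DallaPiazzaSalvatiManni2015, §1 (p0006 of the held text)] -/
theorem secondOrder_thetaConst_not_eventuallyEq_zero (σ : Fin n → ℤ) {τ₀ : Matrix (Fin n) (Fin n) ℂ}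
    (hτ₀ : τ₀ ∈ siegelUpperHalfSpace n) :
    ¬ (fun τ : Matrix (Fin n) (Fin n) ℂ ↦ riemannThetaChar (fun i ↦ (σ i : ℂ) / 2) 0 ((2 : ℂ) • τ) 0) =ᶠ[𝓝 τ₀] 0 := by
  intro h
  -- pull back along the homeomorphism `τ ↦ 2τ`: `ϑ[σ/2; 0](0, ·)` would vanish near `2τ₀ ∈ 𝔥_g`
  have h2 : (2 : ℂ) • τ₀ ∈ siegelUpperHalfSpace n := by
    refine ⟨hτ₀.1.smul _, ?_⟩
    have him : ((2 : ℂ) • τ₀).map Complex.im = (2 : ℝ) • τ₀.map Complex.im := by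
      ext i j; simp
    rw [him]
    exact hτ₀.2.smul two_pos
  have hl : (fun i : Fin n ↦ (((0 : Fin n → ℤ) i : ℤ) : ℂ) / 2) = (0 : Fin n → ℂ) := by
    funext i; simp
  have hev : (fun Ω : Matrix (Fin n) (Fin n) ℂ ↦
      riemannThetaChar (fun i ↦ (σ i : ℂ) / 2) (fun i ↦ (((0 : Fin n → ℤ) i : ℤ) : ℂ) / 2) Ω 0) =ᶠ[𝓝 ((2 : ℂ) • τ₀)] 0 := by
    rw [hl]
    -- `Ω ↦ Ω/2` is continuous and maps `2τ₀` to `τ₀`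
    have hc : Filter.Tendsto (fun Ω : Matrix (Fin n) (Fin n) ℂ ↦ (2 : ℂ)⁻¹ • Ω) (𝓝 ((2 : ℂ) • τ₀)) (𝓝 τ₀) := by
      have := ((continuous_const_smul (2 : ℂ)⁻¹).tendsto ((2 : ℂ) • τ₀))
      rwa [smul_smul, inv_mul_cancel₀ two_ne_zero, one_smul] at this
    have h' := hc.eventually h
    filter_upwards [h'] with Ω hΩ
    simpa only [smul_smul, mul_inv_cancel₀ (two_ne_zero (α := ℂ)), one_smul, Pi.zero_apply] using hΩ
  exact riemannThetaChar_half_zero_not_eventuallyEq_zero σ 0 (by simp) h2 hev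

end Identity

end ComplexTorus

end Literature.Geometry.Kaehler

end
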